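import Summits.BirchSwinnertonDyer.BirchSwinnertonDyer.Theorems.KimAtThreeDeepLowerPortDeepTorsion
import Summits.BirchSwinnertonDyer.BirchSwinnertonDyer.Theorems.KimAtThreeShallowEqDeepSplitGlueNoStub
import Summits.BirchSwinnertonDyer.Rank1Residual.GaloisImage.PropagatedConditionStableRange
import HarnessLib

/-!
# Route `KimAtThreeKolyvagin` (rung W2): cruxes `DeepLowerAtThreeOffKatoStratum` (19679) and `DeepLowerAtThree`
# (19075) BY NAME on EVERY tower row — local `3`-torsion allowed — from PUBLISHED facts + ONE DEEP-guard port
# text of [MR04] Prop. A.2 shape (no S24-DEEP flag, no corner lower halves, no level lowering)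

Cell `bsd-addord`, seat `bsd-addord-w2-c2` (gen 6, owner of 19679; `--supports stmt-BirchSwinnertonDyer-19679`).
Sequel of `KimAtThreeDeepLowerPortDeepTorsion` (the LOWER row at any row from [S24] PINNED + GZK + PT + the deep-guard
port) and the CORRECTED form of `KimAtThreeDeepLowerPortTorsion` §3 (whose pinned-guard port over-asks at `t ≥ 1`,
ERRATUM there).
HONEST FRAMING. TOOL theorems only (no definition, no named fact, no `sorry`); nothing asserted about any curve,
nothing booked; 19075 / 19679 stay OPEN (the theorems conclude the route decls UNDER HYPOTHESES); BSD is not proved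
by any of this.  CONDITIONAL on PUBLISHED facts and ONE displayed port text, PORT@3-TORS-DEEP (FLAG
`K22-Thm3.13-PORT@3`, the cell's one W2 debt class; NOT in print at `3`):

  «for every tower-surjective `W₀`, every `t, M` with `#E(ℚ₃)[3] = 3^t` and `E(ℚ_{v₃})` `3`-power-torsion
  STABLE at `M` (no point of order `3^{M+1}` beyond `3^M`: `3^{M+1}·Q = 0 → 3^M·Q = 0`, n1011 T-DER-BP's `hstab`),
  every generator family `η`, every lattice-optimal datum `P` at the conductor [off the Kato stratum]: SOME `e`
  such that for all depths `k ≤ k′`, all `τ`-data `Dk`, `Dk′` canonical for `η` with primes in the classes of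
  depth `k + M`, `k′ + M` (With-guards `(k + M) k`, `(k′ + M) k′`) and every pinned reduction, the two-depth
  two-exponent witnesses `KatoKuriharaWitnessAtTwoExp W₀ · t e · v₃ P` + (COMP)»

— i.e. acc6's PORT₂ / n1011's PORT″ (B6) shape with the class shift the STABLE LEVEL `M` (where [MR04] App. A
Prop. A.2 puts it: the derivative classes satisfy the canonical condition at `3` on `𝒫_{k+1+M}`; tree:
`PropagatedConditionStableRangeThree.localization_map_red_mem_propagatedSelmerStructure_three`) instead of `t`,
UNLOCKED (no `Addv` / `3 ∤ c₃` / Manin / period antecedent) and at EVERY reduction type.  At `t = 0` one may take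
`M = 0` and the text is w2-c4 g7's PORT@3-OFF / -ALL.  Discharger-to-be: two-depth D6b (see the prequel's docstring).

* `deepLowerAtThreeOffKatoStratum_of_sak_of_portDeepOff : SakamotoKolyvaginThree → RankEqAnalyticRankLeOne →
  PoitouTateSelmerDuality → crux 19679` (every row; `M` from `exists_torsion_stable`, `t` from
  `exists_natCard_threeTorsion_eq_three_pow`, `(v₃, η)` from `exists_place_three_and_generators`).
* `deepLowerAtThree_of_lit_of_portDeepAll : [S24](1) → [S24](2) → GZK → PT → Carayol → crux 19075` (every row; kim3
  g9's optimal-datum reduction; no Kato-stratum split).  The glue form `19678 ∧ PORT-DEEP-OFF ⟹ 19075` is the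
  one-liner `KimAtThreeDeepLowerSplitGlueItem.deepLowerOfParts_proof h19678 (deepLowerAtThreeOffKatoStratum_of_sak_of_portDeepOff
  hOff h19678.1 h19678.2.1 h19678.2.2.1)` (not restated).
References: [MazurRubin2004] App. A Prop. A.2 (pp. 79–80), Thm. 5.2.12; [Kim2022StructureSelmer] Thm. 1.9 (6),
Thm. 3.13, §3.3.2; [Kim2025RefinedTNC] Thm 1.1; [Sakamoto2024] Thm. 4.4 (1)(2); [Carayol1986]; [EdixhovenManin1991] Prop. 2.
-/

set_option autoImplicit false
-- the Theorems namespace of a single-conjunct summit repeats the summit name by design (D-0017)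
set_option linter.dupNamespace false

noncomputable section

open scoped Classical NumberField ContRepresentation
open Function Field NumberField IsDedekindDomain IsDedekindDomain.HeightOneSpectrum WeierstrassCurve
  CongruenceSubgroup
  Literature.NumberTheory.EllipticCurves Literature.NumberTheory.EllipticCurves.ModularForms
  Literature.NumberTheory.EllipticCurves.Rank1Residual
  Literature.NumberTheory.GaloisRepresentations
  Literature.NumberTheory.GaloisRepresentations.DiscreteGaloisModule Literature.NumberTheory.GaloisCohomology
  Rat.HeightOneSpectrum
  Summit.BirchSwinnertonDyer.Rank1Residual.GaloisImage
  Summit.BirchSwinnertonDyer.Rank1Residual.GaloisImage.Assembly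
  Summit.BirchSwinnertonDyer.Rank1Residual.X4

namespace Summit.BirchSwinnertonDyer.BirchSwinnertonDyer.Theorems.KimAtThreeDeepLowerPortDeepTorsionCruxes

open Summit.BirchSwinnertonDyer.BirchSwinnertonDyer.Theses.KimAtThreeKolyvagin
  Summit.BirchSwinnertonDyer.BirchSwinnertonDyer.Theorems.KimAtThreeKolyvaginDefs
  Summit.BirchSwinnertonDyer.BirchSwinnertonDyer.Theorems.KimAtThreeKolyvaginUnitLevelOneRungs
  Summit.BirchSwinnertonDyer.BirchSwinnertonDyer.Theorems.KimAtThreeShallowEqDeepSplitGlueNoStub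
  Summit.BirchSwinnertonDyer.BirchSwinnertonDyer.Theorems.KimAtThreeKolyvaginIsogenyCruxes
  Summit.BirchSwinnertonDyer.BirchSwinnertonDyer.Theorems.KimAtThreeDeepLowerOffStratumAdditiveDefectPortTwoExp
  Summit.BirchSwinnertonDyer.BirchSwinnertonDyer.Theorems.KimAtThreeDeepLowerPortDeepTorsion

/-! ### §1 Crux 19679 BY NAME from PUB + PORT@3-TORS-DEEP-OFF -/

section PortDeepOff

/- PORT@3-TORS-DEEP-OFF (module docstring): deep guards `(k + M) k` / `(k′ + M) k′` at a torsion-STABLE level `M`,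
`t`-slot `t`, `∃ e`, two depths + (COMP); asked only OFF the Kato stratum (crux 19679's antecedent verbatim). -/
variable
  (hPortDeepOff : ∀ (W₀ : WeierstrassCurve ℚ) [W₀.IsElliptic] [W₀.IsGloballyMinimal],
    (∀ n : ℕ, W₀.HasSurjectiveModNGaloisRep (3 ^ n : ℕ)) →
    ∀ (t M : ℕ), Nat.card {Q : (W₀.baseChange ℚ_[3]).toAffine.Point // (3 : ℕ) • Q = 0} = 3 ^ t →
    ∀ (v₃ : HeightOneSpectrum (𝓞 ℚ)), ((3 : ℕ) : 𝓞 ℚ) ∈ v₃.asIdeal →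
    (∀ Q : (W₀.baseChange (v₃.adicCompletion ℚ)).toAffine.Point, 3 ^ (M + 1) • Q = 0 → 3 ^ M • Q = 0) →
    ∀ (η : (q : HeightOneSpectrum (𝓞 ℚ)) → (ZMod (Ideal.absNorm q.asIdeal))ˣ),
      (∀ q, Subgroup.zpowers (η q) = ⊤) →
    ∀ {N : ℕ} [NeZero N] (P : ModularParametrizationData W₀ N), N = W₀.conductorNorm ℤ →
      (∀ z ∈ P.L.lattice, ∃ w ∈ periodLattice P.f, z = P.c * w) →
      ¬ ((haveI : Fact (Nat.Prime 3) := ⟨Nat.prime_three⟩; Addv W₀ 3) ∧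
          ¬ 3 ∣ (W₀.baseChange ℚ_[3]).localTamagawaNumber ℤ_[3] ∧
          Nat.card {Q : (W₀.baseChange ℚ_[3]).toAffine.Point // (3 : ℕ) • Q = 0} = 1 ∧
          ¬ (3 : ℤ) ∣ P.maninConstant) →
      ∃ e : ℕ, ∀ (k k' : ℕ)
        (Dk : KolyvaginDatum (W₀.torsionGaloisModule (((3 : ℕ) : ℤ) ^ k * ((3 : ℕ) : ℤ))))
        (Dk' : KolyvaginDatum (W₀.torsionGaloisModule (((3 : ℕ) : ℤ) ^ k' * ((3 : ℕ) : ℤ))))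
        (red : (W₀.torsionGaloisModule (((3 : ℕ) : ℤ) ^ k' * ((3 : ℕ) : ℤ))).toContRepresentation →ⁱL
          (W₀.torsionGaloisModule (((3 : ℕ) : ℤ) ^ k * ((3 : ℕ) : ℤ))).toContRepresentation),
        Dk.IsCanonicalTauDatumThreeAtWith W₀ (k + M) k η → Dk'.IsCanonicalTauDatumThreeAtWith W₀ (k' + M) k' η →
        k ≤ k' →
        (∀ x : geomTorsion W₀ (((3 : ℕ) : ℤ) ^ k' * ((3 : ℕ) : ℤ)),
          ((red x : geomTorsion W₀ (((3 : ℕ) : ℤ) ^ k * ((3 : ℕ) : ℤ))) : geomPoints W₀) =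
            (((3 : ℕ) : ℤ) ^ (k' - k)) • (x : geomPoints W₀)) →
        ∃ κ Λ κ' κu Λu κu',
          KatoKuriharaWitnessAtTwoExp W₀ k t e Dk v₃ P κ Λ κ' ∧
          KatoKuriharaWitnessAtTwoExp W₀ k' t e Dk' v₃ P κu Λu κu' ∧
          ∀ d, Dk'.IsLevel d → Dk.IsLevel d →
            galoisCohomology.map red 1 (κu d) = κ d ∧ galoisCohomology.map red 1 (κu' d) = κ' d)

include hPortDeepOff

/-- **Crux 19679 `DeepLowerAtThreeOffKatoStratum` BY NAME — EVERY row, the `t ≥ 1` rows included — ⟸ the route's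
leaves `SakamotoKolyvaginThree` (19558), `RankEqAnalyticRankLeOne` (19921), `PoitouTateSelmerDuality` (19559) ∧
PORT@3-TORS-DEEP-OFF.**  At a row: `#E(ℚ₃)[3] = 3^t` (`exists_natCard_threeTorsion_eq_three_pow`), the place above
`3` and a generator family (`exists_place_three_and_generators`), a torsion-STABLE level `M` of `E(ℚ_{v₃})` (n1011's
`exists_torsion_stable` — the `3`-power torsion of `E(ℚ₃)` is finite), the port's `e`, then the prequel's
`deepLower_row_of_portDeep_tors`.  NO S24-DEEP port, no (L_ss)/(L_m)/(LL)/TamDiv, no twin 19562.  CONDITIONAL: does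
not close the item. [cite: MazurRubin2004, App. A Prop. A.2 (pp. 79–80) and Thm. 5.2.12]
[cite: Kim2022StructureSelmer, Thm. 1.9 (6), Thm. 3.13] [cite: Kim2025RefinedTNC, Thm 1.1] [cite: Sakamoto2024, Thm. 4.4 (p. 926)] -/
theorem deepLowerAtThreeOffKatoStratum_of_sak_of_portDeepOff (hSak : SakamotoKolyvaginThree)
    (hGZK : RankEqAnalyticRankLeOne) (hPT : PoitouTateSelmerDuality) : DeepLowerAtThreeOffKatoStratum := by
  intro W₀ _ _ htow _ N _ hN D₀ hopt _ _ hord hoff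
  haveI : Fact (Nat.Prime 3) := ⟨Nat.prime_three⟩
  obtain ⟨t, ht⟩ := exists_natCard_threeTorsion_eq_three_pow W₀
  obtain ⟨v₃, η, hv₃, hη⟩ := exists_place_three_and_generators
  obtain ⟨M, hM⟩ := exists_torsion_stable W₀ 3 v₃
  obtain ⟨e, hPort⟩ := hPortDeepOff W₀ htow t M ht v₃ hv₃ hM η hη D₀ hN hopt hoff
  exact deepLower_row_of_portDeep_tors hSak.1 hSak.2 hGZK hPT W₀ htow hN D₀ t e M hord v₃ hv₃ η hη hPort

end PortDeepOff

/-! ### §2 Crux 19075 BY NAME from PUB + PORT@3-TORS-DEEP-ALL -/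

section PortDeepAll

/- PORT@3-TORS-DEEP-ALL: the same text WITHOUT the off-stratum antecedent. -/
variable
  (hPortDeepAll : ∀ (W₀ : WeierstrassCurve ℚ) [W₀.IsElliptic] [W₀.IsGloballyMinimal],
    (∀ n : ℕ, W₀.HasSurjectiveModNGaloisRep (3 ^ n : ℕ)) →
    ∀ (t M : ℕ), Nat.card {Q : (W₀.baseChange ℚ_[3]).toAffine.Point // (3 : ℕ) • Q = 0} = 3 ^ t →
    ∀ (v₃ : HeightOneSpectrum (𝓞 ℚ)), ((3 : ℕ) : 𝓞 ℚ) ∈ v₃.asIdeal →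
    (∀ Q : (W₀.baseChange (v₃.adicCompletion ℚ)).toAffine.Point, 3 ^ (M + 1) • Q = 0 → 3 ^ M • Q = 0) →
    ∀ (η : (q : HeightOneSpectrum (𝓞 ℚ)) → (ZMod (Ideal.absNorm q.asIdeal))ˣ),
      (∀ q, Subgroup.zpowers (η q) = ⊤) →
    ∀ {N : ℕ} [NeZero N] (P : ModularParametrizationData W₀ N), N = W₀.conductorNorm ℤ →
      (∀ z ∈ P.L.lattice, ∃ w ∈ periodLattice P.f, z = P.c * w) →
      ∃ e : ℕ, ∀ (k k' : ℕ)
        (Dk : KolyvaginDatum (W₀.torsionGaloisModule (((3 : ℕ) : ℤ) ^ k * ((3 : ℕ) : ℤ))))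
        (Dk' : KolyvaginDatum (W₀.torsionGaloisModule (((3 : ℕ) : ℤ) ^ k' * ((3 : ℕ) : ℤ))))
        (red : (W₀.torsionGaloisModule (((3 : ℕ) : ℤ) ^ k' * ((3 : ℕ) : ℤ))).toContRepresentation →ⁱL
          (W₀.torsionGaloisModule (((3 : ℕ) : ℤ) ^ k * ((3 : ℕ) : ℤ))).toContRepresentation),
        Dk.IsCanonicalTauDatumThreeAtWith W₀ (k + M) k η → Dk'.IsCanonicalTauDatumThreeAtWith W₀ (k' + M) k' η →
        k ≤ k' →
        (∀ x : geomTorsion W₀ (((3 : ℕ) : ℤ) ^ k' * ((3 : ℕ) : ℤ)),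
          ((red x : geomTorsion W₀ (((3 : ℕ) : ℤ) ^ k * ((3 : ℕ) : ℤ))) : geomPoints W₀) =
            (((3 : ℕ) : ℤ) ^ (k' - k)) • (x : geomPoints W₀)) →
        ∃ κ Λ κ' κu Λu κu',
          KatoKuriharaWitnessAtTwoExp W₀ k t e Dk v₃ P κ Λ κ' ∧
          KatoKuriharaWitnessAtTwoExp W₀ k' t e Dk' v₃ P κu Λu κu' ∧
          ∀ d, Dk'.IsLevel d → Dk.IsLevel d →
            galoisCohomology.map red 1 (κu d) = κ d ∧ galoisCohomology.map red 1 (κu' d) = κ' d)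

include hPortDeepAll

/-- **Crux 19075 `DeepLowerAtThree` BY NAME ⟸ [S24] Thm. 4.4 (1)(2) (PINNED Literature facts) ∧ GZK ∧
Poitou–Tate ∧ Carayol ∧ PORT@3-TORS-DEEP-ALL** — every row, `t ≥ 1` included; no Kato-stratum split, no PORT″,
no S24-DEEP: kim3 g9's `deepLowerAtThree_of_forall_optimalDatum_atConductor` (Carayol + isogeny invariance +
Edixhoven's optimal datum), then the prequel's `deepLower_row_of_portDeep_tors` at the row's `t`, a stable `M`,
`(v₃, η)` and the port's `e`.  CONDITIONAL: does not close the item. [cite: MazurRubin2004, App. A Prop. A.2 and Thm. 5.2.12]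
[cite: Kim2022StructureSelmer, Thm. 1.9 (6), Thm. 3.13] [cite: Kim2025RefinedTNC, Thm 1.1]
[cite: Sakamoto2024, Thm. 4.4 (p. 926)] [cite: Carayol1986] [cite: EdixhovenManin1991, Prop. 2] -/
theorem deepLowerAtThree_of_lit_of_portDeepAll
    (hS24 : Sakamoto2024.kolyvaginSystems_freeRankOne_zmod_three_pow)
    (hS24₂ : Sakamoto2024.kolyvaginSystems_idealOfBasis_eq_fittingIdeal_zmod_three_pow)
    (hGZK : rank_eq_analyticRank_of_analyticRank_le_one) (hPT : poitouTate_selmerStructure_duality ℚ)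
    (hlev : ∀ (N : ℕ) [NeZero N], IsNewformOf.level_eq_conductorNorm (N := N)) : DeepLowerAtThree := by
  refine deepLowerAtThree_of_forall_optimalDatum_atConductor hlev ?_
  intro W₀ _ _ htow _ N _ hN D₀ hopt _ _ hord
  haveI : Fact (Nat.Prime 3) := ⟨Nat.prime_three⟩
  obtain ⟨t, ht⟩ := exists_natCard_threeTorsion_eq_three_pow W₀
  obtain ⟨v₃, η, hv₃, hη⟩ := exists_place_three_and_generators
  obtain ⟨M, hM⟩ := exists_torsion_stable W₀ 3 v₃
  obtain ⟨e, hPort⟩ := hPortDeepAll W₀ htow t M ht v₃ hv₃ hM η hη D₀ hN hopt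
  exact deepLower_row_of_portDeep_tors hS24 hS24₂ hGZK hPT W₀ htow hN D₀ t e M hord v₃ hv₃ η hη hPort

/-- **Crux 19679 BY NAME ⟸ the same published facts ∧ PORT@3-TORS-DEEP-ALL** (drop the off-stratum antecedent).
[cite: MazurRubin2004, App. A Prop. A.2] [cite: Sakamoto2024, Thm. 4.4 (p. 926)] -/
theorem deepLowerAtThreeOffKatoStratum_of_lit_of_portDeepAll
    (hS24 : Sakamoto2024.kolyvaginSystems_freeRankOne_zmod_three_pow)
    (hS24₂ : Sakamoto2024.kolyvaginSystems_idealOfBasis_eq_fittingIdeal_zmod_three_pow)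
    (hGZK : rank_eq_analyticRank_of_analyticRank_le_one) (hPT : poitouTate_selmerStructure_duality ℚ)
    (hlev : ∀ (N : ℕ) [NeZero N], IsNewformOf.level_eq_conductorNorm (N := N)) :
    DeepLowerAtThreeOffKatoStratum := by
  intro W₀ _ _ htow hfin N _ _ D₀ _ _ hint hord _
  exact deepLowerAtThree_of_lit_of_portDeepAll hPortDeepAll hS24 hS24₂ hGZK hPT hlev W₀ htow hfin D₀.f
    D₀.isNewformOf hint hord

end PortDeepAll

end Summit.BirchSwinnertonDyer.BirchSwinnertonDyer.Theorems.KimAtThreeDeepLowerPortDeepTorsionCruxes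

end
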